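import Summits.BirchSwinnertonDyer.BirchSwinnertonDyer.Theses.PrintCf2
import Summits.BirchSwinnertonDyer.BirchSwinnertonDyer.Theorems.AdditiveRankOneBSDpRowKernels
import Summits.BirchSwinnertonDyer.Rank1Residual.Partition.CornersCM
import Summits.BirchSwinnertonDyer.BirchSwinnertonDyer.Theorems.PrintCf2SplitBadEisensteinTwoBdpComposition
import Literature.NumberTheory.EllipticCurves.HeegnerPointsKolyvaginExceptionalTwistProofs
import Literature.NumberTheory.EllipticCurves.BSDSelmerCMPConverseGoldfeldProofs
import Literature.NumberTheory.EllipticCurves.AnalyticRankOrderProofs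
import Literature.NumberTheory.EllipticCurves.LFunctionSmulProofs
import Summits.BirchSwinnertonDyer.BirchSwinnertonDyer.Theorems.PrintCf2SplitBadEisensteinTwoFrameValue
import Summits.BirchSwinnertonDyer.Rank1Residual.GaloisImage.LocalEulerPoincareCharacteristicHolds
import Literature.NumberTheory.EllipticCurves.Milne1972.WeilRestrictionQuadraticBSDQuotientOfAnyModelProofs
import Literature.NumberTheory.EllipticCurves.AnticyclotomicPrimeDecompositionSplitProofs
import Literature.NumberTheory.GaloisRepresentations.NumberFieldCdTwoProofs
import Summits.BirchSwinnertonDyer.BirchSwinnertonDyer.Theorems.PrintCf2SplitBadEisensteinTwoAtomsRoadSocket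
import Summits.BirchSwinnertonDyer.BirchSwinnertonDyer.Theorems.PrintCf2SplitBadEisensteinTwoControlAtTwoOfAtoms
import Summits.BirchSwinnertonDyer.BirchSwinnertonDyer.Theorems.PrintCf2SplitBadTwoRankOneOfFactsFinGlobTwo
import Summits.BirchSwinnertonDyer.BirchSwinnertonDyer.Theorems.PrintCf2SplitBadEisensteinTwoDivisibilitiesRoad
import Summits.BirchSwinnertonDyer.BirchSwinnertonDyer.Theorems.PrintCf2SplitBadEisensteinTwoDivisibilitiesHalfDescentClass
import Summits.BirchSwinnertonDyer.BirchSwinnertonDyer.Theorems.PrintCf2SplitBadEisensteinTwoFinLocOfOrdinaryFiltration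
import Summits.BirchSwinnertonDyer.BirchSwinnertonDyer.Theorems.PrintCf2SplitBadTwoRankOneOfFactsPrintsTwoOfThree
import Summits.BirchSwinnertonDyer.BirchSwinnertonDyer.Theorems.PrintCf2SplitBadEisensteinTwoOrdinaryFiltrationAtTwo
import HarnessLib

/-!
**v9.6 (LEAD g8, 14:3xZ): Stub F2′ `stub_ordinaryFiltrationAtTwo` CLOSED BY NAME by -w2 g6's p640618 (`import …OrdinaryFiltrationAtTwo`); sorries 5 → 4 =
prints [cite] / existsIntegralBDP [print gap] / upperDivisibility [R-L] / lowerDivisibility [R-XL]. F1, F2, F2′ all closed. No other change.**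

**v9.5 / child v3 (LEAD g7, 13:4xZ): `stub_prints_two` re-cut to THREE named facts (toric inputs, LZZ additive, Milne anyModel) — the two Poitou–Tate
conjuncts are tree theorems, packaged by -w4 g2's `EisensteinTwo.prints_two_of_toric_lzz_milne`; the old five-conjunct bundle is the in-file theorem
`stub_prints_five`. No other change.**

# Line `eisenstein-two-bdp-line` for crux `PrintCf2.SplitBadTwoRankOneOfFacts` (stmt-BirchSwinnertonDyer-20368)

**v9.4 (+3 h): F2′ switched to -w2 g5's recommended CM-FREE turnkey (B): `stub_ordinaryFiltrationAtTwo` (= the binder `hFilt` of p633758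
`EisensteinTwo.finLoc_two_of_ordinaryFiltration`, VERBATIM; one D_𝔭-stable line + unit-root characters; their discharge roadmap F-A…F-D targets it).**

**v9.3 (+2.5 h): `stub_finLoc_two` CLOSED in-file modulo the NEW cite-level stub `stub_cmLocalLinesAtTwo` (= the binder `hLines` of -w2 g5's
p632925 `EisensteinTwo.finLoc_two_of_cmLocalLines`, VERBATIM: the local CM lines of the class at `2` with their Frobenius characters). Registered
stubs: prints [cite] / existsIntegralBDP [print gap] / upperDivisibility [R-L] / lowerDivisibility [R-XL] / cmLocalLinesAtTwo [cite-level,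
discharge road CM-free (-w2 g5)]; finGlob and finLoc are theorems in-file. No research stub is «provable mathematics left undone» any more.**

**v9.2 (+2 h): NO stub change (stubs byte-identical to v9.1). The composition now runs THROUGH THE TWO HALVES: `kolyvaginHalf_of_stubs`
(`stub_upperDivisibility_two` alone ⟹ `MissingUpperBoundAt W 2`, i.e. `ord₂ #Ш(W) ≤ ord₂ #Ш_an(W)`, on the class) and `eisensteinHalf_of_stubs`
(`stub_lowerDivisibility_two` alone ⟹ `MissingLowerBoundAt W 2`), by the lead's one-sided descent p631598/p631859/p632496; `_of_stubs` =
`bsdp_of_missingPPartAt ∘ missingPPartAt_of_lower_of_upper`. So each one-sided research stub carries EXACTLY one half of the crux's BSD₂ clause.**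

**v9.1 (+1 h): `stub_prints_two` re-cut to FIVE named facts — Burungale–Flach 2024 (`bsdTriple_of_hasCM_of_L_one_ne_zero`) is the fourth conjunct
of the crux's own bundle 𝔅_split and is now supplied from there (`prints_two … hB.2.2.2.1`); nothing else changes.**

**v9-LEAD (bsd-line-cf2-p1 g7, 2026-08-28T12:1xZ) — THE DIVISIBILITIES ROAD (normalisation-free, one-sided): `stub_finGlob_two` CLOSED
(-w4 g0, p628209, imported); the three Λ-adic stubs of v8.1 (halved frame `2·Q̃` / halved inclusion / halved match) REPLACED by the v5–v7
UN-HALVED frame stub `stub_existsIntegralBDP_two` (text verbatim) and TWO ONE-SIDED divisibility stubs with NO `2`-power normalisation of `Q`: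
`stub_upperDivisibility_two` (`∃ h, ‖h(0)‖ ≤ 1/2 ∧ (Q) ⊆ (h)·Ch·𝓞⟦T⟧` — the Euler-system direction; at `T = 0` the UPPER bound on `#Ш[2^∞]`)
and `stub_lowerDivisibility_two` (`∃ g, ‖g(0)‖ ≥ 1/2 ∧ (g)·Ch·𝓞⟦T⟧ ⊆ (Q)` — the Eisenstein-congruence direction; the LOWER bound).** Why (lead g7
finding, kernel p628661 `…DivisibilitiesCore` + `…DivisibilitiesRoad`): v8.1's `Q = 2·Q̃` (`μ(Q) ≥ 1`) is a guess — D2b + control-0 + Cassels–Tate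
pin only `T = 0` data, the interpolation points of `R1.IsBDPLFunctionInt 2` lie in a disc `|T| ≤ |u−1| < 1` and do not see the Gauss norm of `Q`,
so the λ-shift bookkeeping `(Q) = (T − t₀)·Ch`, `‖t₀‖ = 1/2`, `μ(Q) = 0` is equally consistent (and Hida/Hsieh's μ-heuristic `f^♭ = f ≡ q mod 2 ≢ 0`
leans that way), under which `stub_existsHalvedBDP_two` is false. Road B is the special case `h = g = 2` of v9 (`EisensteinTwo.divisibilities_of_halvedIMCEq`),
the λ-shift is `h = g = T − t₀`; v9's research content is implied by v8.1's. Stubs of record (5 open + 1 closed): `stub_prints_two` [cite] ·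
`stub_existsIntegralBDP_two` [print gap, v5–v7 text] · `stub_upperDivisibility_two` [R-L] · `stub_lowerDivisibility_two` [R-XL] · `stub_finLoc_two`
[M, verbatim; -w2 g4: true on the class, kernel chain p627218/p628031/p627732 landed, residual = cite-level local CM structure (R1)(R2)] ·
`stub_finGlob_two` [CLOSED p628209, kept as a one-line theorem for the record]. Composition: `EisensteinTwo.splitBadTwoRankOneOfFacts_of_eisensteinTwoBdpDivisibilities`.
History (v1–v8.1) follows.

**v8.1 (same day, +20 min): `stub_torsion_two` DROPPED — -w2 g4's `EisensteinTwo.descent_two_of_socket` (p625457's sibling, tree 10:49Z, `…AtomsRoadSocket.lean`) takes the Λ-torsion of `X_(∅,0)` at `𝔭′` from the control socket itself (`XAc.HasCharValuationAt` carries `Module.IsTorsion`), so Λ-torsion is no longer a separate research statement: it is a THEOREM of F1/F2 + PT at every Heegner datum. Stubs of record (6): prints / existsHalvedBDP / halvedEisensteinIncl / halvedInvariantMatch / finGlob / finLoc.**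

**v8-LEAD (bsd-line-cf2-p1 g6, 2026-08-28T10:44Z) — ROAD B («atoms road»): the factor of 2 moves to the analytic side; the control stub is
REPLACED by two torsion-finiteness stubs and becomes a THEOREM.** Why: the lead's p625474 (`EisensteinTwo.additiveControlOnTreeAt_two_of_finAtoms`,
cell bsd-schneider's torsion-aware (∅,0) control machine run at `p = 2`, Brink at `l = 2` = p624809) gives control with DEFECT 0 modulo
(Fin_glob) ∧ (Fin_loc) ∧ Poitou–Tate, so v7's `stub_control_two` (+1) is FALSE modulo those atoms (p625474 §2) and v7's typed frame + IMC-equality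
are inconsistent with BSD₂ / with the crux (p625474 §3, companion §4); -w2 g4's BSD-free parity obstruction (p624788) and plan g8's FS1 numerics
(j305479: the K-side identity holds on 58/58 pairs) agree. The consistent bookkeeping (road B, -w2 g4 `PrintCf2SplitBadEisensteinTwoAtomsRoad`):
the Castella-normalised ♭-BDP function at `2` is `2·Qh`, `Qh` integral, the ♭-IMC reads `Ch·𝓞⟦T⟧ = (Qh)`, control has defect 0.
v8 stubs (7): `stub_prints_two` [cite, as v7] · `stub_existsHalvedBDP_two` [print gap: frame predicate on `2 * Qh`] · `stub_torsion_two` [verbatim]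
· `stub_halvedEisensteinIncl_two` [XL] · `stub_halvedInvariantMatch_two` [L] · `stub_finGlob_two` [S/M, NEW: `E(K_∞)[2^∞]` finite] ·
`stub_finLoc_two` [M, NEW: `LocalTowerTorsionFiniteAt (E_K) 2 κ 𝔭`]. DERIVED in file: «PRINTS(2)» (3 conjuncts are tree theorems), Milne on a
minimal model, the upgrade from the match (algebra of §2), **the control socket `AdditiveControlOnTreeAt 2` from F1/F2 + PT (lead p625474)**, and
the crux via the cell's τ = 0 row kernel `EisensteinTwo.descent_two_of_controlZero` + the Burungale–Flach twin socket. Research content left: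
halved frame existence / Λ-torsion / halved inclusion / halved match (the Λ-adic Eisenstein-congruence programme at 2, now with ONE consistent
2-power normalisation) + two finiteness statements that are provable mathematics (CM Galois image; local CM characters at 2), not open problems.
History (v1–v7) follows.

**v7-LEAD (bsd-line-cf2-p1 g6, 2026-08-28T09:53Z) — THE MILNE ROAD, registered by the lead.** Two changes to the registered
859a52ca set, everything else VERBATIM: (1) `stub_grossLink_two` [research-S] is DROPPED — the cell's landed D2c assembly
`Theorems.PrintCf2.EisensteinTwo.descent_two_of_controlValueTied` (-w2 g3, p621946) derives the old descent statement from the TIED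
control/value statement (here `controlValue_two_of_control_two` ∘ `stub_control_two`, PROVED) plus ONE refereed print, Milne 1972 §1 Thm 1
(Weil restriction of scalars; tree named fact `Milne1972.bsdQuotient_baseChange_quadratic`, obtained from the any-model form
`…_anyModel` = item 24149 by the tree theorem `bsdQuotient_baseChange_quadratic_of_anyModel`), through cell bsd-p2's over-`K` road; no
`IndexLowerBoundLeAt`/`IndexUpperBoundLeAt` bookkeeping at `2` is needed, so the joint-calibration caveat of v5/v6 disappears (given frames +
IMC equality + Milne + `BSD₂` of the twin, `stub_control_two`'s `+1` is EQUIVALENT to `BSD₂(W)`: `EisensteinTwo.kSideIdentity_iff_correction_eq_one`).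
(2) `stub_prints_two` is RE-CUT to the conjuncts that are NOT tree theorems plus Milne: three of the eight «PRINTS(2)» conjuncts are
kernel theorems (`localEulerPoincareCharacteristic_holds` — Summits-side, cell b2b-bsdres; `fieldCdLE_two_of_numberField_holds`;
`decomp_not_le_kerSubgroup_of_isAnticyclotomic_holds`) and are DISCHARGED in `prints_two` below, which rebuilds «PRINTS(2)» verbatim for
the consumers. Stubs of record after v7 (6): `stub_prints_two` [cite: toric inputs, LZZ, BF24, Poitou–Tate ×2, Milne] ·
`stub_existsIntegralBDP_two` [print gap] · `stub_torsion_two` · `stub_flatEisensteinIncl_two` [XL] · `stub_invariantMatch_two` [L] ·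
`stub_control_two` [M] — four research statements, all Λ-adic/control-shaped at the Eisenstein `2`, none `BSD₂`-valued.
History (v1–v6) follows; the v6 paragraph's description of the descent derivation is superseded by (1).

Seat bsd-idea-7 (D-0145 ideator), generation g3, lens «complete» (program-completion). BSD is not proved by any of this;
nothing here asserts anything about any curve: seven `sorry`'d stubs (one cite-level, one print gap, five research), closed lemmas
(the Greenberg–Vatsal algebraic upgrade, v2; the `p`-generic PORT of the descent, v3), one kernel-checked composition concluding the crux
BY NAME. v3 (critic V#19 P2): the former descent stub is CUT into a tied control/value stub and a Gross-link stub, and the rest is PROVED.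
v4 (09:20Z) = the lead's first registration d31d09ce ⊕ the v2/v3 cuts. v5-LEAD (09:32Z): the lead bsd-line-cf2-p1 g5 took v4,
SHARPENED the tied stub to `stub_control_two` (defect exactly `+1`, pinned by the cell's landed `2`-adic display), proved
`controlValue_two_of_control_two`, wrote the file (commit af842843ae9b) and REGISTERED it as skeleton **859a52caf8e1b3b4 = THE LINE OF RECORD**
(stubs: prints / existsIntegralBDP / torsion / flatEisensteinIncl / invariantMatch / control / grossLink). This seat's own v5 (commit
e844e77117ee, `stub_controlTwo_two` + `stub_milne_two`, the cell's Milne road), written at 09:34:27Z WITHOUT having seen the 09:32Z registration,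
overwrote that file 90 seconds after it — a race, the second such; apologies to the cell. **v6 (this file, 09:55Z) RESTORES the line of record:
the seven stubs are the registered 859a52ca names and statements VERBATIM (five from this seat's v4, `stub_control_two` copied from the ledger's
skeleton record, `stub_grossLink_two` = v4's), `controlValue_two_of_control_two` is re-proved here (t := 1; value conjunct = the cell's
`EisensteinTwo.intSeries_value_of_frame_manin_two`), the descent is DERIVED by v4's port `indexHalves_of_tied` + `stub_grossLink_two`
(`descent_two_of_controlValue_of_grossLink`), the upgrade by `invariantUpgrade_two_of_match`, and the composition is the lead's tree theorem
`Theorems.PrintCf2.splitBadTwoRankOneOfFacts_of_eisensteinTwoBdp`.** The Milne road (v5; -w2's landed `descent_two_of_controlValueTied` /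
`descent_two_of_controlTwo`) remains the documented alternative for stub 5: under EITHER registry choice the old descent stub is a theorem modulo
one research stub (control) and one link (Gross link here, Milne 1972 there). PUBLISH-ONLY (ruling W-79): this seat registers nothing and will
not write to this path again in g3.

THE CLASS. `W` globally minimal over `ℚ`, CM by `K₀ = ℚ(√−7)` (`2 = 𝔭𝔭̄` split in `K₀`), BAD (additive, potentially good
ordinary) at `2`, `r_an(W) = 1`: the `ℚ`-models of `49a1^{(d)}`, `d` squarefree, `d ≢ 1 (mod 4)`. Every member has
`W(ℚ)[2] = ℤ/2` and `W[2] ⊂ W(K₀)`: the prime `2` is an EISENSTEIN prime of the newform `f_W`, with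
`ρ̄_{W,2}^{ss} = 𝟙 ⊕ 𝟙`.

THE LEVER (new on this crux). Every line so far on item 20368 reads `BSD(W,2)` either on the CYCLOTOMIC `ℤ₂`-line of `K₀`
(line `ltyz_zeta8_trichotomy`: LTYZ (II) with the inertia-type trichotomy; wall L★ = the additive local index of cyclotomic
control + the 2-adic Gross–Zagier formula) or at VALUE level over a `2`-split auxiliary Heegner field `K''`
(line `parity_crossing_two`: the L-free Heegner-index identity, ⟺ item 19140 modulo prints; card `tower-translate-two-mod-eight`:
the cyclotomic sheet of the good partner). This line is the Λ-ADIC ANTICYCLOTOMIC one and uses the reducibility at `2` as a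
RESOURCE: over a Heegner field `K''` of `N_W` with `2` split in `K''`, on the anticyclotomic `ℤ₂`-line, the (∅,0) («♭-BDP»)
Selmer condition at the two primes `v, v̄ ∣ 2` is «everything at `v`, nothing at `v̄`» and is BLIND to the (additive)
fibre of `W` at `2`; the (∅,0) main conjecture for `f_W` over `K''_∞` is then cut à la Greenberg–Vatsal / Castella–Grossi–Lee–Skinner:
ONE inclusion from the Eisenstein congruence at `2` (lattice construction), and the UPGRADE to equality by matching `μ, λ` with the two characters of `ρ̄^{ss}`, here both
TRIVIAL: the comparison modules are the `2`-class-group Iwasawa modules of the anticyclotomic `ℤ₂`-tower of `K''`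
(`μ = 0`: Oukhaba–Viguié at `p = 2`; class-number side: Ferrero/Kida-type formulas), and the analytic comparison is with the
product of two anticyclotomic Katz–Kubota–Leopoldt `2`-adic `L`-functions of `K''` (printed congruences NEAR this: Kriz 2016, BDP ≡ Katz·Katz
in anticyclotomic families at an Eisenstein GOOD `p` (ANT 10, Assumptions 1: `p ∤ N`, `p` split, `D_K` odd); Kriz–Li 2019 Thm 1.16, VALUE-level log-congruence between congruent cusp forms at
ANY `p` incl. `2`, `p` split in `K`, «based on direct p-adic integration», and Thm 1.20 = 7.1, the Eisenstein case, `p` ODD; the Λ-adic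
Eisenstein congruence at `p = 2` is unprinted). The tree already hosts Greenberg–Vatsal AT
`p = 2` as a technique (route `EisensteinDepletionAtTwo`, tree theorems `lam_mul_eulerFactorProduct_two`,
`order_map_toZMod_eulerFactorElement_two` — cyclotomic, good ordinary, non-CM); here it is transposed to the anticyclotomic
(∅,0) line of a CM curve additive at `2`.

THE CUT (typed at the literal prime `2`; none of the stubs is `BSD₂` of anything, none implies the crux alone):
* `stub_prints_two`             — «PRINTS(2)»: NAMED Literature facts verbatim (the toric published inputs, Liu–Zhang–Zhang 2018
                                   at an additive prime — typed in the tree WITHOUT a parity guard —, Burungale–Flach 2024, and the five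
                                   cohomological facts of the control doors). Cite-level; book via an `…OfFactsPlus` twin, not a prover task.
* `stub_existsIntegralBDP_two`  — an INTEGRAL ♭-BDP frame `(Ω_K, Ω_p, Q)`, `Q ∈ 𝓞_{ℂ₂}⟦T⟧`, EXISTS for `f_W` at `2` over every `2`-split
                                   Heegner field of `N_W` (Hsieh 2014 Thm. A is typed with `p ≠ 2`: `thmA_exists_isHsiehLFunction_unrPeriod_anyLevel`;
                                   LZZ give the analytic function at any `p`; integrality = `μ`-type normalisation at `2`). PRINT GAP.
* `stub_torsion_two`           — `X_(∅,0)(W/K_∞)` at `𝔭′` is `Λ`-TORSION at every anticyclotomic frame (the LEAD's repair, registered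
                                   d31d09ce verbatim: `XAc.charIdeal` is `⊤` off torsion, so stubs 2/3/4 carry `Module.IsTorsion …`). RESEARCH.
* `stub_flatEisensteinIncl_two` — ♭-(∅,0) Eisenstein INCLUSION `Ch·𝓞_{ℂ₂}⟦T⟧ ⊆ (Q)` at `p = 2` on the class (Λ-adic; RESEARCH).
* `stub_invariantMatch_two`     — the Greenberg–Vatsal INVARIANT MATCH at `2` (both residual characters trivial), typed generator-free:
                                   a degree `n` below which the coefficients of `Q` are non-units and at which some element of `Ch·𝓞_{ℂ₂}⟦T⟧` has
                                   a UNIT coefficient («`μ_alg = 0`, `λ(Q) ≥ λ_alg`»); with the inclusion it gives the ♭-IMC EQUALITY by the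
                                   PROVED algebraic upgrade `span_le_of_le_span_of_match` (§2: `Q ∣ G` + match ⟹ `Q ~ G`, ultrametric
                                   inequality in `𝓞_{ℂ₂}⟦T⟧`, no Weierstrass preparation). RESEARCH with a blueprint; the algebra is closed.
* `stub_control_two`           — (v6 = the lead's registered statement) anticyclotomic (∅,0) CONTROL at `T = 0` at `𝔭′ ∣ 2` with net
                                  defect EXACTLY `+1`; v4's tied form (control AND the `2`-adic Waldspurger
                                   VALUE `Q(𝟙) = u·(log_ω P/c)²`, with their `2`-power defects TIED to one integer `t` (`‖u‖ = 2^{−t}`,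
                                   control `+ t`). Deliberately NOT the odd-`p` predicate `SchneiderFree.AdditiveControlOnTreeAt` (= `t = 0`,
                                   no torsion term: there `W(ℚ_p)[p] = 0`), nor a hand-fixed `2`-adic constant (here `W(K)[2] = ℤ/2`, and
                                   LZZ Thm 1.5.1/1.5.3 carry `2^{1−2n}`, `(2/h_K)²`; the tree's display unit `ι⁻¹(8/(s·4·√|d_K|))` is a unit
                                   only for `p ∤ 2`): under the ♭-IMC equality the two defects are the same number, so only the tie is asserted.
                                   RESEARCH-M, algebraic (JSW Thm. 3.3.1 at an Eisenstein `2`, with torsion and `v ∣ 2` local terms) + analytic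
                                   (`2`-adic Waldspurger bookkeeping); the additive fibre at `2` re-enters HERE, in the control term.
* `stub_grossLink_two`         — the `K → ℚ` descent of `BSD₂` on the class: the EXACT `2`-adic Gross index identity over `K` (both tree
                                   predicates `IndexLowerBoundLeAt` / `Upper.IndexUpperBoundLeAt W 2 K P (v₂ c)`; Gross 1991 Conj. (2.2)) +
                                   `BSD₂` of the rank-zero twist ⟹ `BSD₂(W)` — the `p = 2` analogue of the tree's odd-`p` terminal link
                                   `bsdp_of_exactIndexManin_of_partner_bsdp` (which needs `p ∤ #𝓞_K^× = 2`); in substance Milne's restriction of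
                                   scalars + isogeny invariance, or Kramer; CM tool in the tree: `P2.bsdp_two_iff_cmHeegnerIndex`. RESEARCH-S.
PORT, PROVED in this file (§2b, any `p`): `norm_constantCoeff_eq_of_span_eq`, `indexHalves_of_tied` (tied control/value + ♭-IMC equality ⟹
both index halves over `K`: the defect CANCELS), `descent_two_of_controlValue_of_grossLink` (the v1/v2 statement of `stub_descent_two`,
now a theorem of stubs 4 + 5).
CLOSED in this file: `rankZeroTwistBSDp_two_of_hasCM` — the rank-zero twist socket from Burungale–Flach 2024 (a conjunct of the crux's own
fact bundle), consumed by the composition `SplitBadTwoRankOneOfFacts_of` (no `sorry`).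

WHY NOT CRUX-EQUIVALENT (critic idea-crit-10 standing demand, 06:51Z). The lead's kernel facts `…_iff_goldfeld19140`,
`parityCrossingTransferTwo_iff_splitBadTwoRankOneOfFacts` concern VALUE statements. The inclusion and upgrade stubs are inclusions of ideals
of `𝓞_{ℂ₂}⟦T⟧` on the anticyclotomic line and the existence stub is a statement about `f_W` alone; `BSD₂(W)` for one `W` gives none of
them (it is one specialisation of the Λ-adic statement, and only after the `2`-adic Waldspurger formula). The Gross-link stub IS implied by
the crux modulo the fact bundle — as is every statement concluding `BSD₂` on the class — and is used TOWARD the crux (BC2 direction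
recorded): it is consequence-shaped, strictly weaker than the crux (its converse needs the other four), never served as «the» crux. The
tied control/value stub concludes no `BSD₂`: it is a statement about `X_(∅,0)` and `Q` at one Heegner datum, implied by `BSD₂(W)` only
through the ♭-IMC equality AND the Gross identity over `K` (i.e. through stubs 2, 3, 5), never alone.

BARRIERS. `IwasawaTheoryAtTwo` (entries: signed supersingular theory at `2`; CYCLOTOMIC additive-prime theory at `2`, Delbourgo):
evaded by clause — no cyclotomic object over `ℚ`, no signed object; the line lives on the anticyclotomic line of a `2`-split `K''`
with the (∅,0) condition. `TwoDescentDefectUnbounded` / fixed-level descent: not met (no fixed-level descent; the point of the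
Λ-adic line is uniformity in `d` where Ш(W)[2] ≠ 0, e.g. `d = −310, −470`, p4 census). `ReducibleAnticyclotomicAtBadP`
(`PrintedEisensteinAnticyclotomicScope = Good ∨ Irr`): the line is inside the complement ON PURPOSE (reducible and bad at `2`); it
evades the barrier's mechanism (no Euler system, no Kolyvagin primes, no big image) but not its scope sentence — it does not; the bet
is that the congruence method, whose input is reducibility, extends to `p = 2 ∣ N`. HONEST PRICE: every algebraic anticyclotomic
statement at `p = 2` is unprinted (Howard, Bertolini, CGLS, CGS: `p` odd); the analytic congruence is printed in families only
at good `p` (Kriz 2016, `p ∤ N`) and at `p = 2` only at VALUE level between cusp forms (Kriz–Li 2019 Thm 1.16; their Eisenstein Thm 7.1 is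
`p` odd; their Rem. 1.10/1.14: «the p-converse … is not known for p an additive and Eisenstein prime», «… for p = 2 is not known»);
`μ = 0` for the `2`-adic Katz functions of `K''` is Oukhaba–Viguié 2016 (Forum Math. 28) — to be re-read for the anticyclotomic branch.

DEAD LINES AVOIDED. `splitbad-birth` (j-cut, content-free); Kriz–Li Thm 1.12 (needs `E(K)[2] = 0`; not used — only the
congruence MECHANISM of Kriz–Li §3 is invoked, where reducibility is the setting); Shu–Zhai / CLTZ / Zhai (odd parameter or
`r_an = 0`); cyclotomic IMC over `ℚ` at additive `2` (barrier); `ltyz` L★ (cyclotomic control index at the additive fibre — absent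
on the (∅,0) line); `parity_crossing_two` S2 (value identity ⟺ 19140 — not a stub here); `tower-translate` (cyclotomic sheet).
DISPROOF / NEGATIVES: no `Disproof.lean` registered for this crux; `ledger negatives --problem BirchSwinnertonDyer` has no
Λ-adic statement; the p4 censuses (|d| ≤ 600: 236 × Ш_an = 1, 2 × Ш_an = 4) contradict nothing here.

References: Castella–Grossi–Lee–Skinner, Invent. Math. 227 (2022) (arXiv:2008.02571) §1 p. 4 and Thm. 3.2.1; Greenberg–Vatsal,
Invent. Math. 142 (2000); Kriz–Li, Forum Math. Sigma 7 (2019) (doi:10.1017/fms.2019.9); Jetchev–Skinner–Wan, Camb. J. Math. 5 (2017)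
§7.4.1; Hsieh, Doc. Math. 19 (2014) Thm. A; Liu–Zhang–Zhang, Duke Math. J. 167 (2018); Burungale–Flach 2024 Cor. 2; Oukhaba–Viguié,
Forum Math. 28 (2016) (the `μ`-invariant of Katz `p`-adic `L`-functions, `p = 2, 3`); Li–Tian–Yan–Zhu, PAMQ 2025 §1.3.
-/

noncomputable section

open scoped Classical

set_option linter.dupNamespace false
set_option autoImplicit false

namespace Summit.BirchSwinnertonDyer.BirchSwinnertonDyer.Cruxes.SplitBadTwoRankOneOfFacts.EisensteinTwoBdpLine

open WeierstrassCurve NumberField IsDedekindDomain Field PowerSeries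
  Literature.NumberTheory.EllipticCurves
  Literature.NumberTheory.EllipticCurves.ModularForms
  Literature.NumberTheory.EllipticCurves.Rank1Residual
  Literature.NumberTheory.EllipticCurves.Rank1Residual.Typed
  Literature.NumberTheory.GaloisRepresentations
  Literature.NumberTheory.GaloisCohomology
  Summit.BirchSwinnertonDyer.Rank1Residual
  Summit.BirchSwinnertonDyer.Rank1Residual.Additive
  Summit.BirchSwinnertonDyer.Rank1Residual.X11b
  Summit.BirchSwinnertonDyer.Rank1Residual.X11b.AcSelmer
  Summit.BirchSwinnertonDyer.Rank1Residual.X11b.Halves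
  Summit.BirchSwinnertonDyer.Rank1Residual.X11b.CongruenceLimit
  Summit.BirchSwinnertonDyer.BirchSwinnertonDyer.Theses.UniversalToricDescent
  Summit.BirchSwinnertonDyer.BirchSwinnertonDyer.Theorems
  Summit.BirchSwinnertonDyer.BirchSwinnertonDyer.Theorems.SchneiderFree
  Summit.BirchSwinnertonDyer.BirchSwinnertonDyer.Theorems.SchneiderFreeControlAtoms
  Summit.BirchSwinnertonDyer.BirchSwinnertonDyer.Theorems.SchneiderFreeAdditiveX3
  Summit.BirchSwinnertonDyer.BirchSwinnertonDyer.Theorems.UniversalToricDescentWaldspurgerFlat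

/-! ## §1 The stubs of v9.4 (all at the literal prime `2`): Stub 0 (v9.1 re-cut); Stub 1 = the v5–v7 UN-HALVED frame; Stubs U/D = the two ONE-SIDED divisibilities (lead g7); F1 CLOSED (p628209); F2 CLOSED modulo F2′ = the cite-level ordinary filtration at 2 (p633758) -/

/-- **Stub 0 `stub_prints_two` [CITE-LEVEL; v9.5 re-cut: THREE named facts — toric inputs (item 20389), Liu–Zhang–Zhang additive, Milne anyModel (item 24149);
the two Poitou–Tate conjuncts are now tree theorems (-w4 g2's `prints_two_of_toric_lzz_milne`, bsd-schneider's `…_holds`), Burungale–Flach comes from 𝔅_split].** The named published inputs that are NOT tree theorems and NOT in 𝔅_split hold: the toric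
published inputs (`ToricPublishedInputs`, item 20389), Liu–Zhang–Zhang 2018 Thm 1.5.1 + 1.5.3 at an additive prime, Poitou–Tate duality for
Selmer structures and for `Ш`, and (v7) Milne 1972 §1 Thm 1 in the any-model form (= item 24149 `MilneAnyModel`). The three cohomological conjuncts of the v1–v6 bundle that ARE kernel theorems (local Euler–Poincaré
characteristic, `cd₂ ≤ 2` for number fields, finite decomposition of degree-one primes in the anticyclotomic tower) are discharged in
`prints_two`; Burungale–Flach (CM rank zero) comes from 𝔅_split. Not a prover task: book via an `…OfFactsPlus` twin carrying these FIVE named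
facts (K7t pattern). [cite: LiuZhangZhang2018, Thm 1.5.1 and Thm 1.5.3 (Duke Math. J. 167 pp. 745–751)]
[cite: Milne1972ArithmeticAV, §1 Thm. 1 (p. 182) and §2 Prop. 6 (a), Prop. 7] [cite: MilneADT2006, Ch. I Thm. 4.10 (Poitou–Tate)] -/
theorem stub_prints_two :
    (ToricPublishedInputs ∧
      LiuZhangZhang2018.thm151_thm153_modularCurve_heegnerVector_additive ∧
      Milne1972.bsdQuotient_baseChange_quadratic_anyModel) := by
  sorry

/-- **The five-conjunct print bundle of v9.1–v9.4 from the THREE-fact Stub 0** (v9.5): the two Poitou–Tate conjuncts are tree theorems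
(`SchneiderFreeAdditiveX3.PoitouTateReduction.poitouTate_selmerStructure_duality_holds` / `…poitouTate_sha_tateDual_holds`, cell bsd-schneider,
2026-08-28), packaged by -w4 g2's `EisensteinTwo.prints_two_of_toric_lzz_milne` (`Theorems/PrintCf2SplitBadTwoRankOneOfFactsPrintsTwoOfThree`).
CONDITIONAL on Stub 0. [cite: MilneADT2006, Ch. I Thm. 4.10 (Poitou–Tate)] -/
theorem stub_prints_five :
    (ToricPublishedInputs ∧
      LiuZhangZhang2018.thm151_thm153_modularCurve_heegnerVector_additive ∧
      (∀ (K : Type) [Field K] [NumberField K], poitouTate_selmerStructure_duality K) ∧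
      (∀ (K : Type) [Field K] [NumberField K], poitouTate_sha_tateDual K) ∧
      Milne1972.bsdQuotient_baseChange_quadratic_anyModel) :=
  Summit.BirchSwinnertonDyer.BirchSwinnertonDyer.Theorems.PrintCf2.EisensteinTwo.prints_two_of_toric_lzz_milne stub_prints_two

/-- **Stub 1 `stub_existsIntegralBDP_two` [PRINT GAP — an integral ♭-BDP frame exists at `2`; v9 = the v5–v7 registered text VERBATIM (un-halved)].**
For `W/ℚ` globally minimal with CM, `r_an(W) = 1`, CM-split and bad at `2`: at every Heegner field `K` of `N_W` (so `2` splits in `K`: the frame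
prime `𝔭 ∋ 2` has degree one), every anticyclotomic frame `(κ, γ, 𝔭)` and every embedding datum `ι'` inducing `𝔭`, there is a frame
`(Ω_K, Ω_p, Q)` with `Ω_K ≠ 0`, `Ω_p ≠ 0`, `Q ∈ 𝓞_{ℂ₂}⟦T⟧` having Castella's interpolation property `R1.IsBDPLFunctionInt 2 …` for the newform
`Dt.f` of `W` (level `N_W`, `2⁴ ∣ N_W`, `a₂(f) = 0`: `f^♭ = f`, Euler-type factor `1`). v9 drops v8's extra claim `Q = 2·Q̃` (`μ(Q) ≥ 1`): the
interpolation points lie in a disc `|T| ≤ |u − 1| < 1` and pin `Q` (Strassmann on that disc, `BDPFrameUniquenessInt`) but say nothing about its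
Gauss norm; NO `2`-power normalisation of `Q` is asserted here or below. Mechanism: Liu–Zhang–Zhang's distribution («PRINTS(2)», any `p`,
any `π_p`) gives the analytic function with these interpolation values; integrality = `μ`-type normalisation at `2` (Hida–Tilouine / Hsieh CM
periods at `p = 2`). Why it might fail: Hsieh 2014 Thm. A (the integral construction) is printed and typed for `p` odd only
(`thmA_exists_isHsiehLFunction_unrPeriod_anyLevel` carries `p ≠ 2`); at `p = 2` the toric period integral for the dyadic SUPERCUSPIDAL `π_2(f_W)`
and the `2`-adic CM periods may force a positive `μ`-type denominator, i.e. no integral normalisation with `Ω_p ≠ 0` of the required shape; or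
the universal constants of `bdpInterpolationValue` at `p = 2` may be incompatible with ANY `Q ∈ 𝓞⟦T⟧` (an `n`-dependent non-unit factor).
[cite: Hsieh2014, Thm. A p. 712 (Doc. Math. 19)] [cite: LiuZhangZhang2018, Thm 1.5.1 (Duke Math. J. 167 p. 748)] -/
theorem stub_existsIntegralBDP_two :
    (ToricPublishedInputs ∧
      LiuZhangZhang2018.thm151_thm153_modularCurve_heegnerVector_additive ∧
      bsdTriple_of_hasCM_of_L_one_ne_zero ∧
      (∀ (K : Type) [Field K] [NumberField K], poitouTate_selmerStructure_duality K) ∧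
      (∀ (K : Type) [Field K] [NumberField K], poitouTate_sha_tateDual K) ∧
      (∀ (K : Type) [Field K] [NumberField K] (v : HeightOneSpectrum (𝓞 K)),
        localEulerPoincareCharacteristic (v.adicCompletion K)) ∧
      fieldCdLE_two_of_numberField ∧
      (∀ (K : Type) [Field K] [NumberField K] (p : ℕ) [Fact p.Prime],
        ZpExtension.decomp_not_le_kerSubgroup_of_isAnticyclotomic K p)) →
    ∀ (W : WeierstrassCurve ℚ) [W.IsElliptic] [W.IsGloballyMinimal],
      W.HasCM → W.analyticRank = 1 → CMSplit W 2 → ¬ Good W 2 →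
      ∀ (N : ℕ) [NeZero N] (K : Type) [Field K] [NumberField K] (Dt : ModularParametrizationData W N),
        W.conductorNorm ℤ = N → IsImaginaryQuadratic K → SatisfiesHeegnerHypothesis N K →
        ∀ (κ : ZpExtension K 2), κ.IsAnticyclotomic → ∀ (γ : Field.absoluteGaloisGroup K) [Fact (κ.IsTopGenerator γ)]
          (𝔭 : HeightOneSpectrum (𝓞 K)), ((2 : ℕ) : 𝓞 K) ∈ 𝔭.asIdeal → 𝔭.asIdeal.ramificationIdx (𝓞 ℚ) = 1 →
          𝔭.asIdeal.inertiaDeg (𝓞 ℚ) = 1 → ∀ (ι' : PadicAlgCl 2 ≃+* ℂ), SchneiderFree.BranchInducesPrime 2 ι' 𝔭 →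
          ∃ (ΩK : ℂ) (Ωp : ℂ_[2]) (Q : PowerSeries (PadicComplexInt 2)),
            ΩK ≠ 0 ∧ Ωp ≠ 0 ∧ R1.IsBDPLFunctionInt 2 ι' 𝔭 κ γ Dt.f ΩK Ωp Q := by
  sorry

/-- **Stub U `stub_upperDivisibility_two` [RESEARCH-L — the EULER-SYSTEM DIRECTION at the Eisenstein `2`, normalisation-free; v9, NEW].** For the class:
at every Heegner field `K` of `N_W` (`2 = 𝔭𝔭'` split in `K`), every anticyclotomic frame, every second degree-one prime `𝔭' ≠ 𝔭`, every embedding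
datum `ι'` inducing `𝔭` and every integral ♭-frame `Q` of `f_W` at `2` (UN-HALVED), under Λ-torsion of `X_(∅,0)(W/K_∞)` at `𝔭'` (supplied by the
control socket): there is `h ∈ 𝓞_{ℂ₂}⟦T⟧` with `‖h(0)‖ ≤ 1/2` and `(Q) ⊆ (h)·Ch_Λ(X_(∅,0))·𝓞_{ℂ₂}⟦T⟧` — «the characteristic ideal DIVIDES the
`2`-adic `L`-function, with at least one extra non-unit at `T = 0`». At `T = 0` (with the socket and D2b) it gives EXACTLY the `2`-adic UPPER bound
`ord₂ #Ш(E/K)[2^∞] + ord₂ ∏c_w ≤ 2·ord₂[E(K):ℤP] − 2·ord₂ c` (`EisensteinTwo.charExponent_le_of_upperDivisibility_two`, p628661) — one BSD₂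
INEQUALITY, not `BSD₂`. Holds in road B (`h = 2`) and in the λ-shift bookkeeping (`h = T − t₀`); fails in the refuted v7 bookkeeping `(Q) = Ch` (p624788:
the extra non-unit is forced by Cassels–Tate parity). Mechanism: the (∅,0) Beilinson–Flach / Heegner-point Kolyvagin-system divisibility
`Ch(X_(∅,0)) ∣ L_𝔭^{BDP}` (Castella–Hsieh / CGLS Thm. 3.2.1 / BDP–Howard, all `p` odd, `p ∤ N`), to be run at the Eisenstein `2` for a CM form additive
at `2` — with `ρ̄^{ss} = 𝟙 ⊕ 𝟙` no big-image Euler-system argument is available; the CM structure (`V = ψ ⊕ ψ^c` over `K·K₀`) is the substitute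
(Rubin-style, cf. line `rubin_value_two` S3). Why it might fail: every printed (∅,0) divisibility takes `p` odd, `p ∤ N` and residually irreducible
`ρ̄`; at `p = 2` the Kolyvagin-system machine needs `2`-adic Cartan/commutation input (cf. ty2's `CMKolyvaginCartanCommuteAtTwo`, p626910) and the
`μ`-part of the divisibility is exactly what is unknown. [cite: CastellaGrossiLeeSkinner2022, Thm. 3.2.1 (Invent. Math. 227) (odd p, shape)]
[cite: JetchevSkinnerWan2017, Thm. 3.3.1 (arXiv:1512.06894 p. 11) (shape)] -/
theorem stub_upperDivisibility_two :
    ∀ (W : WeierstrassCurve ℚ) [W.IsElliptic] [W.IsGloballyMinimal],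
      W.HasCM → W.analyticRank = 1 → CMSplit W 2 → ¬ Good W 2 →
      ∀ (N : ℕ) [NeZero N] (K : Type) [Field K] [NumberField K] (Dt : ModularParametrizationData W N),
        W.conductorNorm ℤ = N → IsImaginaryQuadratic K → SatisfiesHeegnerHypothesis N K →
        ∀ (κ : ZpExtension K 2), κ.IsAnticyclotomic → ∀ (γ : Field.absoluteGaloisGroup K) [Fact (κ.IsTopGenerator γ)]
          (𝔭 : HeightOneSpectrum (𝓞 K)), ((2 : ℕ) : 𝓞 K) ∈ 𝔭.asIdeal → 𝔭.asIdeal.ramificationIdx (𝓞 ℚ) = 1 →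
          𝔭.asIdeal.inertiaDeg (𝓞 ℚ) = 1 → ∀ (𝔭' : HeightOneSpectrum (𝓞 K)), ((2 : ℕ) : 𝓞 K) ∈ 𝔭'.asIdeal → 𝔭' ≠ 𝔭 →
          ∀ (ι' : PadicAlgCl 2 ≃+* ℂ), SchneiderFree.BranchInducesPrime 2 ι' 𝔭 →
          ∀ (ΩK : ℂ) (Ωp : ℂ_[2]) (Q : PowerSeries (PadicComplexInt 2)), ΩK ≠ 0 → Ωp ≠ 0 →
            R1.IsBDPLFunctionInt 2 ι' 𝔭 κ γ Dt.f ΩK Ωp Q →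
            Module.IsTorsion (IwasawaAlgebra 2) (XAc (W.baseChange K) 2 κ 𝔭' ∅ γ) →
            ∃ h : PowerSeries (PadicComplexInt 2), ‖((PowerSeries.constantCoeff h : 𝓞_ℂ_[2]) : ℂ_[2])‖ ≤ 2⁻¹ ∧
              Ideal.span {Q} ≤ Ideal.span {h} * (XAc.charIdeal (W.baseChange K) 2 κ 𝔭' ∅ γ).map (PowerSeries.map (R1.toCpInt 2)) := by
  sorry

/-- **Stub D `stub_lowerDivisibility_two` [RESEARCH-XL — the EISENSTEIN-CONGRUENCE DIRECTION at `2`, normalisation-free; v9, NEW; the line's hardest].**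
On the same rows and frames: there is `g ∈ 𝓞_{ℂ₂}⟦T⟧` with `‖g(0)‖ ≥ 1/2` and `(g)·Ch_Λ(X_(∅,0))·𝓞_{ℂ₂}⟦T⟧ ⊆ (Q)` — «the `2`-adic `L`-function
DIVIDES `g` times the characteristic ideal, `g` at most one factor `2` at `T = 0`». At `T = 0` it gives EXACTLY the `2`-adic LOWER bound
`ord₂ #Ш(E/K)[2^∞] + ord₂ ∏c_w ≥ 2·ord₂[E(K):ℤP] − 2·ord₂ c` (`EisensteinTwo.charExponent_ge_of_lowerDivisibility_two`, p628661). Holds in road B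
(`g = 2`) and in the λ-shift bookkeeping (`g = T − t₀`, `‖t₀‖ = 1/2`); with Stub U it recovers v8.1's ♭-IMC «up to `g`» and the EXACT `K`-side identity.
It REPLACES v8.1's pair (halved Eisenstein inclusion `Ch ⊆ (Q̃)`, halved Greenberg–Vatsal match): the lattice construction from the congruence
`f_W ≡` (Eisenstein) `mod 2^k` along the CM family produces (∅,0) classes and the lower bound on `X_(∅,0)` (JSW step L / Wan / CGS §3 / Kriz–Li §3
shape), the invariant match (`μ_alg = 0` via the `2`-class-group Iwasawa modules of `K_∞^{ac}`, Oukhaba–Viguié `μ = 0` at `p = 2`) upgrades it to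
«`Q ∣ g·Ch`». Why it might fail: the congruence modulo `2` alone is too weak, every printed (∅,0) lower bound takes `p` odd, `p ∤ N` and a
finite-slope `p`-stabilisation (here `π_2` supercuspidal), and the Greenberg–Vatsal error terms at `2` are `2`-groups of `μ`-type.
[cite: JetchevSkinnerWan2017, §7.4.1 (arXiv:1512.06894 p. 30)] [cite: KrizLi2019, §3 and Thm. 1.16] [cite: GreenbergVatsal2000, Thm. 1.3] -/
theorem stub_lowerDivisibility_two :
    ∀ (W : WeierstrassCurve ℚ) [W.IsElliptic] [W.IsGloballyMinimal],
      W.HasCM → W.analyticRank = 1 → CMSplit W 2 → ¬ Good W 2 →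
      ∀ (N : ℕ) [NeZero N] (K : Type) [Field K] [NumberField K] (Dt : ModularParametrizationData W N),
        W.conductorNorm ℤ = N → IsImaginaryQuadratic K → SatisfiesHeegnerHypothesis N K →
        ∀ (κ : ZpExtension K 2), κ.IsAnticyclotomic → ∀ (γ : Field.absoluteGaloisGroup K) [Fact (κ.IsTopGenerator γ)]
          (𝔭 : HeightOneSpectrum (𝓞 K)), ((2 : ℕ) : 𝓞 K) ∈ 𝔭.asIdeal → 𝔭.asIdeal.ramificationIdx (𝓞 ℚ) = 1 →
          𝔭.asIdeal.inertiaDeg (𝓞 ℚ) = 1 → ∀ (𝔭' : HeightOneSpectrum (𝓞 K)), ((2 : ℕ) : 𝓞 K) ∈ 𝔭'.asIdeal → 𝔭' ≠ 𝔭 →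
          ∀ (ι' : PadicAlgCl 2 ≃+* ℂ), SchneiderFree.BranchInducesPrime 2 ι' 𝔭 →
          ∀ (ΩK : ℂ) (Ωp : ℂ_[2]) (Q : PowerSeries (PadicComplexInt 2)), ΩK ≠ 0 → Ωp ≠ 0 →
            R1.IsBDPLFunctionInt 2 ι' 𝔭 κ γ Dt.f ΩK Ωp Q →
            Module.IsTorsion (IwasawaAlgebra 2) (XAc (W.baseChange K) 2 κ 𝔭' ∅ γ) →
            ∃ g : PowerSeries (PadicComplexInt 2), 2⁻¹ ≤ ‖((PowerSeries.constantCoeff g : 𝓞_ℂ_[2]) : ℂ_[2])‖ ∧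
              Ideal.span {g} * (XAc.charIdeal (W.baseChange K) 2 κ 𝔭' ∅ γ).map (PowerSeries.map (R1.toCpInt 2)) ≤ Ideal.span {Q} := by
  sorry

/-- **Stub F1 `stub_finGlob_two` [CLOSED — -w4 g0, p628209 `EisensteinTwo.stub_finGlob_two`; kept VERBATIM for the record, no `sorry`].** For `W` in
the class and every imaginary quadratic `K` and anticyclotomic `κ`: `E(K_∞)[2^∞]` is finite. PROVED for EVERY `E/ℚ` (Shafarevich over `ℚ` +
`Γ_ℚ`-stability of the fixed module of the dihedral extension `K_∞/ℚ` + Weil pairing: `μ_{2^∞} ⊄ K_∞`).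
[cite: GreenbergLNM1716, §3 Lemma 3.1 and §4 Lemma 4.3] [cite: Brink2007, §II Prop. 1 (p. 2130)] -/
theorem stub_finGlob_two :
    ∀ (W : WeierstrassCurve ℚ) [W.IsElliptic] [W.IsGloballyMinimal],
      W.HasCM → W.analyticRank = 1 → CMSplit W 2 → ¬ Good W 2 →
      ∀ (K : Type) [Field K] [NumberField K], IsImaginaryQuadratic K →
        ∀ (κ : ZpExtension K 2), κ.IsAnticyclotomic →
          Finite (FixedPoints.addSubgroup κ.kerSubgroup (geomPrimaryTorsion (W.baseChange K) 2)) :=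
  Summit.BirchSwinnertonDyer.BirchSwinnertonDyer.Theorems.PrintCf2.EisensteinTwo.stub_finGlob_two

/-- **Stub F2′ `stub_ordinaryFiltrationAtTwo` [CLOSED BY NAME — -w2 g6, p640618 `EisensteinTwo.stub_ordinaryFiltrationAtTwo` (unconditional; v9.6); kept VERBATIM; formerly CITE-LEVEL — the local ORDINARY filtration of the class at `2` with its characters; v9.4 = -w2 g5's
recommended CM-FREE turnkey (B), replacing v9.3's `stub_cmLocalLinesAtTwo` (turnkey (A)); `stub_finLoc_two` is CLOSED in-file modulo this display by
p633758 `EisensteinTwo.finLoc_two_of_ordinaryFiltration`].** For `W` in the class, `K` imaginary quadratic and a degree-one `𝔭 ∣ 2` of `K`: there is ONE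
`D_𝔭`-stable line `C ≤ E[2^∞]` (the formal-group line of the good ordinary model over `K_𝔭(√d)`) and the unit root `α ∈ ℤ₂ˣ` of `X² − X + 2`
(`a₂(X₀(49)) = 1`) such that every Frobenius-degree-`n` element `σ` of `Γ_{K_𝔭}` acts on `(E[2^∞]/C)[2^k]` by `±α^{n}` and on `C[2^k]` by
`±ε(σ)·α^{−n}` — Greenberg's ordinary filtration (tree: `ellipticOrdinaryReduction_tateModule_filtration_holds`, PROVED) + «Frobenius acts on `Ẽ[2^k]`
by the unit root» (Manin's relation `φ² − aφ + 2 = 0` + Hensel; the one brick not yet in the tree) + twist transport; text = the binder `hFilt` of p633758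
VERBATIM. -w2 g5's discharge roadmap (F-A…F-D) targets exactly this statement. [cite: GreenbergLNM1716, §2 (pp. 62–64)] [cite: SerreTate1968, §4 Cor. 2]
[cite: SilvermanAEC2009, Thm. V.3.1 and Prop. VII.2.1 (reduction on torsion)] -/
theorem stub_ordinaryFiltrationAtTwo :
    ∀ (W : WeierstrassCurve ℚ) [W.IsElliptic] [W.IsGloballyMinimal],
    W.HasCM → W.analyticRank = 1 → CMSplit W 2 → ¬ Good W 2 →
    ∀ (K : Type) [Field K] [NumberField K], IsImaginaryQuadratic K →
      ∀ (𝔭 : HeightOneSpectrum (𝓞 K)), ((2 : ℕ) : 𝓞 K) ∈ 𝔭.asIdeal → 𝔭.asIdeal.ramificationIdx (𝓞 ℚ) = 1 →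
        𝔭.asIdeal.inertiaDeg (𝓞 ℚ) = 1 →
        ∃ (C : AddSubgroup ((W.baseChange K).geomPrimaryTorsion 2)) (α : ℤ_[2]ˣ),
          (α : ℤ_[2]) ^ 2 = (α : ℤ_[2]) - 2 ∧
          ∀ (σ : absoluteGaloisGroup (𝔭.adicCompletion K)) (n : ℕ), IsFrobPow σ (n : ℤ) →
            ∃ s₁ s₂ : ℤ, (s₁ = 1 ∨ s₁ = -1) ∧ (s₂ = 1 ∨ s₂ = -1) ∧
              (∀ (k : ℕ) (x : (W.baseChange K).geomPrimaryTorsion 2), 2 ^ k • x ∈ C →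
                ∀ N : ℤ, ((N : ℤ_[2]) - s₂ * ((α ^ n : ℤ_[2]ˣ) : ℤ_[2])) ∈
                    (Ideal.span {(2 : ℤ_[2]) ^ k} : Ideal ℤ_[2]) →
                  absGaloisRestrict K (𝔭.adicCompletion K) σ • x - N • x ∈ C) ∧
              (∀ (k : ℕ) (c : (W.baseChange K).geomPrimaryTorsion 2), c ∈ C → 2 ^ k • c = 0 →
                ∀ N : ℤ, ((N : ℤ_[2]) - s₁ *
                    ((GaloisRep.cyclotomicCharacter K 2 (absGaloisRestrict K (𝔭.adicCompletion K) σ) * (α⁻¹) ^ n :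
                      ℤ_[2]ˣ) : ℤ_[2])) ∈ (Ideal.span {(2 : ℤ_[2]) ^ k} : Ideal ℤ_[2]) →
                  absGaloisRestrict K (𝔭.adicCompletion K) σ • c = N • c) := by
  exact Summit.BirchSwinnertonDyer.BirchSwinnertonDyer.Theorems.PrintCf2.EisensteinTwo.stub_ordinaryFiltrationAtTwo

/-- **Stub F2 `stub_finLoc_two` [CLOSED in-file modulo Stub F2′ — -w2 g5, p633758 (CM-free ordinary-filtration form); kept VERBATIM for the record, no `sorry`].** For `W` in the
class, `K` imaginary quadratic, `κ` anticyclotomic and a degree-one `𝔭 ∣ 2`: `E(K_{∞,𝔭})[2^∞]` is finite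
(`SchneiderFreeControlAtoms.LocalTowerTorsionFiniteAt (E_K) 2 κ 𝔭`): from the ordinary filtration (Stub F2′) by the anticyclotomic norm-residue
mover `σ₀` at `2` (p627732), the weight lemma (`α^n ≠ ±1`) and the filtration principle (p628031) — `EisensteinTwo.finLoc_two_of_ordinaryFiltration`.
[cite: GreenbergLNM1716, §3 Lemma 3.3 (p. 73)] [cite: Brink2007, Cor. 1 (p. 2136)] -/
theorem stub_finLoc_two :
    ∀ (W : WeierstrassCurve ℚ) [W.IsElliptic] [W.IsGloballyMinimal],
      W.HasCM → W.analyticRank = 1 → CMSplit W 2 → ¬ Good W 2 →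
      ∀ (K : Type) [Field K] [NumberField K], IsImaginaryQuadratic K →
        ∀ (κ : ZpExtension K 2), κ.IsAnticyclotomic →
          ∀ (𝔭 : HeightOneSpectrum (𝓞 K)), ((2 : ℕ) : 𝓞 K) ∈ 𝔭.asIdeal → 𝔭.asIdeal.ramificationIdx (𝓞 ℚ) = 1 →
            𝔭.asIdeal.inertiaDeg (𝓞 ℚ) = 1 →
            SchneiderFreeControlAtoms.LocalTowerTorsionFiniteAt (W.baseChange K) 2 κ 𝔭 :=
  Summit.BirchSwinnertonDyer.BirchSwinnertonDyer.Theorems.PrintCf2.EisensteinTwo.finLoc_two_of_ordinaryFiltration stub_ordinaryFiltrationAtTwo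

/-! ### §2b (v7) The print bundle «PRINTS(2)» rebuilt from Stub 0: three conjuncts are kernel theorems -/

/-- **«PRINTS(2)» (the v1–v6 eight-conjunct bundle, verbatim) from the v7 Stub 0**: the local Euler–Poincaré characteristic
(`localEulerPoincareCharacteristic_holds`, any non-archimedean local field of characteristic `0`), `cd₂ ≤ 2` for number fields
(`fieldCdLE_two_of_numberField_holds`) and the anticyclotomic decomposition fact (`decomp_not_le_kerSubgroup_of_isAnticyclotomic_holds`,
Brink 2007) are THEOREMS of the tree; Burungale–Flach is the crux bundle's (`hBF`, v9.1); the other four conjuncts are Stub 0's. CONDITIONAL. -/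
theorem prints_two
    (h0 : ToricPublishedInputs ∧
      LiuZhangZhang2018.thm151_thm153_modularCurve_heegnerVector_additive ∧
      (∀ (K : Type) [Field K] [NumberField K], poitouTate_selmerStructure_duality K) ∧
      (∀ (K : Type) [Field K] [NumberField K], poitouTate_sha_tateDual K) ∧
      Milne1972.bsdQuotient_baseChange_quadratic_anyModel)
    (hBF : bsdTriple_of_hasCM_of_L_one_ne_zero) :
    (ToricPublishedInputs ∧
      LiuZhangZhang2018.thm151_thm153_modularCurve_heegnerVector_additive ∧
      bsdTriple_of_hasCM_of_L_one_ne_zero ∧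
      (∀ (K : Type) [Field K] [NumberField K], poitouTate_selmerStructure_duality K) ∧
      (∀ (K : Type) [Field K] [NumberField K], poitouTate_sha_tateDual K) ∧
      (∀ (K : Type) [Field K] [NumberField K] (v : HeightOneSpectrum (𝓞 K)),
        localEulerPoincareCharacteristic (v.adicCompletion K)) ∧
      fieldCdLE_two_of_numberField ∧
      (∀ (K : Type) [Field K] [NumberField K] (p : ℕ) [Fact p.Prime],
        ZpExtension.decomp_not_le_kerSubgroup_of_isAnticyclotomic K p)) :=
  ⟨h0.1, h0.2.1, hBF, h0.2.2.1, h0.2.2.2.1,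
    fun K _ _ v ↦ by
      haveI : CharZero (v.adicCompletion K) := charZero_of_injective_algebraMap (algebraMap K _).injective
      exact localEulerPoincareCharacteristic_holds (v.adicCompletion K),
    fieldCdLE_two_of_numberField_holds,
    ZpExtension.decomp_not_le_kerSubgroup_of_isAnticyclotomic_holds⟩

/-- **Milne 1972 on a globally minimal `K`-model from the any-model print** (tree theorem
`Milne1972.bsdQuotient_baseChange_quadratic_of_anyModel`): the form the cell's D2c assembly consumes. CONDITIONAL on Stub 0's last conjunct.
[cite: Milne1972ArithmeticAV, §1 Thm. 1 (p. 182)] -/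
theorem milne_two (h0 : ToricPublishedInputs ∧
      LiuZhangZhang2018.thm151_thm153_modularCurve_heegnerVector_additive ∧
      (∀ (K : Type) [Field K] [NumberField K], poitouTate_selmerStructure_duality K) ∧
      (∀ (K : Type) [Field K] [NumberField K], poitouTate_sha_tateDual K) ∧
      Milne1972.bsdQuotient_baseChange_quadratic_anyModel) :
    Milne1972.bsdQuotient_baseChange_quadratic :=
  Milne1972.bsdQuotient_baseChange_quadratic_of_anyModel h0.2.2.2.2

/-! ### §2c (v8) The control socket at `2`, DEFECT 0, DERIVED from the two finiteness stubs (lead g6, p625474) -/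

/-- **Anticyclotomic (∅,0) control at `T = 0` at the Eisenstein `2` with defect `0` (`SchneiderFree.AdditiveControlOnTreeAt 2`), at every
Heegner datum of every class member — the socket `hD2a₀` of the cell's τ = 0 row kernel `EisensteinTwo.descent_two_of_controlZero`
(-w2 g4) — is a THEOREM of Stub F1 + Stub F2 + Poitou–Tate** (conjuncts of Stub 0), by the lead's
`EisensteinTwo.additiveControlOnTreeAt_two_of_finAtoms` (p625474: cell bsd-schneider's torsion-aware control machine run at `p = 2`,
Brink at `l = 2` from p624809). `W` additive at `2` (CM is never multiplicative), `2 ∣ N_W` so `2` splits in the Heegner field, rank one and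
`Ш(E/K)` finite from the Kolyvagin binder. This REPLACES v5–v7's research stub `stub_control_two` (defect `+1`), refuted modulo (Fin) by
p625474 §2. CONDITIONAL on its displayed hypotheses; closes nothing. [cite: JetchevSkinnerWan2017, Thm. 3.3.1 (arXiv:1512.06894 p. 11)]
[cite: Brink2007, Thm. 2 and Cor. 1] -/
theorem controlZero_two_of_fin
    (hPT : ∀ (K : Type) [Field K] [NumberField K], poitouTate_selmerStructure_duality K)
    (hPT2 : ∀ (K : Type) [Field K] [NumberField K], poitouTate_sha_tateDual K)
    (hFG : ∀ (W : WeierstrassCurve ℚ) [W.IsElliptic] [W.IsGloballyMinimal],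
      W.HasCM → W.analyticRank = 1 → CMSplit W 2 → ¬ Good W 2 →
      ∀ (K : Type) [Field K] [NumberField K], IsImaginaryQuadratic K →
        ∀ (κ : ZpExtension K 2), κ.IsAnticyclotomic →
          Finite (FixedPoints.addSubgroup κ.kerSubgroup (geomPrimaryTorsion (W.baseChange K) 2)))
    (hFL : ∀ (W : WeierstrassCurve ℚ) [W.IsElliptic] [W.IsGloballyMinimal],
      W.HasCM → W.analyticRank = 1 → CMSplit W 2 → ¬ Good W 2 →
      ∀ (K : Type) [Field K] [NumberField K], IsImaginaryQuadratic K →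
        ∀ (κ : ZpExtension K 2), κ.IsAnticyclotomic →
          ∀ (𝔭 : HeightOneSpectrum (𝓞 K)), ((2 : ℕ) : 𝓞 K) ∈ 𝔭.asIdeal → 𝔭.asIdeal.ramificationIdx (𝓞 ℚ) = 1 →
            𝔭.asIdeal.inertiaDeg (𝓞 ℚ) = 1 →
            SchneiderFreeControlAtoms.LocalTowerTorsionFiniteAt (W.baseChange K) 2 κ 𝔭) :
    ∀ (W : WeierstrassCurve ℚ) [W.IsElliptic] [W.IsGloballyMinimal],
      W.HasCM → W.analyticRank = 1 → CMSplit W 2 → ¬ Good W 2 →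
      ∀ (N : ℕ) [NeZero N] (K : Type) [Field K] [NumberField K] (Dt : ModularParametrizationData W N)
        (H : HeegnerDatum N (NumberField.discr K)) (ι : K →+* ℂ) (P : (W.baseChange K).toAffine.Point),
        W.conductorNorm ℤ = N → IsImaginaryQuadratic K → SatisfiesHeegnerHypothesis N K →
        (W.quadraticTwist (NumberField.discr K : ℚ)).entireLFunction 1 ≠ 0 →
        WeierstrassCurve.Affine.Point.map ι.toRatAlgHom P = heegnerPointComplex Dt H → ¬ IsOfFinAddOrder P →
        Literature.NumberTheory.EllipticCurves.kolyvagin N W K →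
        ∀ (κ : ZpExtension K 2), κ.IsAnticyclotomic → ∀ (γ : Field.absoluteGaloisGroup K) [Fact (κ.IsTopGenerator γ)]
          (𝔭 : HeightOneSpectrum (𝓞 K)) (h𝔭 : ((2 : ℕ) : 𝓞 K) ∈ 𝔭.asIdeal) (he : 𝔭.asIdeal.ramificationIdx (𝓞 ℚ) = 1)
          (hf : 𝔭.asIdeal.inertiaDeg (𝓞 ℚ) = 1),
          SchneiderFree.AdditiveControlOnTreeAt 2 κ 𝔭 γ (embAt K 2 𝔭 h𝔭 he hf) P := by
  intro W _ _ hCM hr hsplit2 hng N _ K _ _ Dt H ι P hN hK hHN _hLt hP hnt hKo κ hκ γ _ 𝔭 h𝔭 he hf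
  -- `W` is additive at `2` (CM is never multiplicative), so `4 ∣ N_W`, `2 ∣ N_W` and `2` splits in `K`
  have hadd : Addv W 2 := ⟨hng, Literature.NumberTheory.EllipticCurves.Rank1Residual.not_mult_of_hasCM (W := W) hCM 2⟩
  have h4N : 2 ^ 2 ∣ W.conductorNorm ℤ := by
    by_contra h
    rcases hasGoodReductionAtPrime_or_hasMultiplicativeReductionAtPrime_of_not_sq_dvd_conductorNorm (V := W) h with hg | hm
    · exact hng hg
    · exact hadd.2 hm
  have h2N : (2 : ℕ) ∣ W.conductorNorm ℤ := dvd_trans (dvd_pow_self 2 two_ne_zero) h4N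
  have hsplit : SplitsIn K 2 := SchneiderFreeAdditiveX3.splitsIn_of_satisfiesHeegnerHypothesis hN hHN h2N
  -- rank one and `Ш(E/K)` finite (Kolyvagin)
  obtain ⟨hrank, hSha⟩ := hKo hK hHN ⟨Dt, H, ι, hP⟩ hnt
  exact Summit.BirchSwinnertonDyer.BirchSwinnertonDyer.Theorems.PrintCf2.EisensteinTwo.additiveControlOnTreeAt_two_of_finAtoms
    (hPT K) (hPT2 K) W hadd hK hsplit h2N hrank hSha P hnt κ hκ γ 𝔭 h𝔭 he hf
    (hFG W hCM hr hsplit2 hng K hK κ hκ) (hFL W hCM hr hsplit2 hng K hK κ hκ 𝔭 h𝔭 he hf)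


/-! ## §3 The kernel-checked composition (v9.2): each one-sided stub gives one HALF of BSD₂ on the class; the two halves give the crux BY NAME -/

/-- **The Euler-system HALF from `stub_upperDivisibility_two` ALONE** (with Stub 0, Stub 1, F1 (closed), F2 and two conjuncts of 𝔅_split:
Burungale–Flach for the twin and the print bundle, modularity for the twin): for every `W` in the class, `#Ш_an(W)` is rational and
`ord₂ #Ш(W) ≤ ord₂ #Ш_an(W)` (`MissingUpperBoundAt W 2`). The lower divisibility is NOT used. Lead g7's one-sided descent
(`EisensteinTwo.missingUpperBoundAt_two_of_upperDivisibility_of_socket`, p632496 ← p631859 ← p631598). -/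
theorem kolyvaginHalf_of_stubs (hBF : bsdTriple_of_hasCM_of_L_one_ne_zero) (hmod : hasEntireLFunction_rat) :
    ∀ (W : WeierstrassCurve ℚ) [W.IsElliptic] [W.IsGloballyMinimal],
      W.HasCM → W.analyticRank = 1 → CMSplit W 2 → ¬ Good W 2 → MissingUpperBoundAt W 2 := by
  intro W _ _ hCM hr hsplit hng
  have hPr := prints_two stub_prints_five hBF
  exact Summit.BirchSwinnertonDyer.BirchSwinnertonDyer.Theorems.PrintCf2.EisensteinTwo.missingUpperBoundAt_two_of_upperDivisibility_of_socket
    (milne_two stub_prints_five) (controlZero_two_of_fin hPr.2.2.2.1 hPr.2.2.2.2.1 stub_finGlob_two stub_finLoc_two) hPr W hCM hr hsplit hng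
    (stub_existsIntegralBDP_two hPr W hCM hr hsplit hng) (stub_upperDivisibility_two W hCM hr hsplit hng)
    (Summit.BirchSwinnertonDyer.BirchSwinnertonDyer.Theorems.PrintCf2.rankZeroTwistBSDp_two_of_hasCM_of_print hBF hmod W hCM)

/-- **The Eisenstein HALF from `stub_lowerDivisibility_two` ALONE**: for every `W` in the class, `ord₂ #Ш_an(W) ≤ ord₂ #Ш(W)`
(`MissingLowerBoundAt W 2`). The upper divisibility is NOT used. (`EisensteinTwo.missingLowerBoundAt_two_of_lowerDivisibility_of_socket`.) -/
theorem eisensteinHalf_of_stubs (hBF : bsdTriple_of_hasCM_of_L_one_ne_zero) (hmod : hasEntireLFunction_rat) :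
    ∀ (W : WeierstrassCurve ℚ) [W.IsElliptic] [W.IsGloballyMinimal],
      W.HasCM → W.analyticRank = 1 → CMSplit W 2 → ¬ Good W 2 → MissingLowerBoundAt W 2 := by
  intro W _ _ hCM hr hsplit hng
  have hPr := prints_two stub_prints_five hBF
  exact Summit.BirchSwinnertonDyer.BirchSwinnertonDyer.Theorems.PrintCf2.EisensteinTwo.missingLowerBoundAt_two_of_lowerDivisibility_of_socket
    (milne_two stub_prints_five) (controlZero_two_of_fin hPr.2.2.2.1 hPr.2.2.2.2.1 stub_finGlob_two stub_finLoc_two) hPr W hCM hr hsplit hng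
    (stub_existsIntegralBDP_two hPr W hCM hr hsplit hng) (stub_lowerDivisibility_two W hCM hr hsplit hng)
    (Summit.BirchSwinnertonDyer.BirchSwinnertonDyer.Theorems.PrintCf2.rankZeroTwistBSDp_two_of_hasCM_of_print hBF hmod W hCM)

/-- **The crux from the six named stubs of v9.2, THROUGH THE TWO HALVES** (the only `sorry`s are inside `stub_*`; `stub_finGlob_two` is
closed): `BSDp W 2` = rank/finiteness (GZK, the first conjunct of 𝔅_split, `bsdp_of_missingPPartAt`) + the two one-sided halves
(`missingPPartAt_of_lower_of_upper`). Equivalent to v9/v9.1's route through the lead's two-sided composition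
`EisensteinTwo.splitBadTwoRankOneOfFacts_of_eisensteinTwoBdpDivisibilities` (p629097), which remains in the tree. -/
theorem SplitBadTwoRankOneOfFacts_of_stubs :
    Summit.BirchSwinnertonDyer.BirchSwinnertonDyer.Theses.PrintCf2.SplitBadTwoRankOneOfFacts := by
  intro hB W _ _ hCM hr hsplit hng
  exact bsdp_of_missingPPartAt W 2 hB.1 (by rw [hr])
    (missingPPartAt_of_lower_of_upper W 2 (eisensteinHalf_of_stubs hB.2.2.2.1 hB.2.1 W hCM hr hsplit hng)
      (kolyvaginHalf_of_stubs hB.2.2.2.1 hB.2.1 W hCM hr hsplit hng))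

end Summit.BirchSwinnertonDyer.BirchSwinnertonDyer.Cruxes.SplitBadTwoRankOneOfFacts.EisensteinTwoBdpLine
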